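import Mathlib.Algebra.MvPolynomial.PDeriv
import Mathlib.Analysis.SpecialFunctions.ExpDeriv
import Mathlib.Analysis.Calculus.FDeriv.Pi
import Mathlib.Analysis.Calculus.Deriv.Mul
import Mathlib.Analysis.Calculus.Deriv.Pi
import Mathlib.Analysis.Calculus.ContDiff.Operations
import Mathlib.LinearAlgebra.Matrix.Determinant.Basic
import Mathlib.LinearAlgebra.Determinant
import Mathlib.LinearAlgebra.Matrix.ToLin
import HarnessLib

/-!
# Jacobians of flat exponential polynomial maps `x̄ ↦ P(x̄, e^{x̄})` and their algebraic transfer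

Family `periods` (periods.S27), topic `Literature/ModelTheory/ExponentialFields`: support for the
Schanuel step (B3) of the decomposition of the conditional half of Macintyre–Wilkie's theorem
(`Literature.ModelTheory.ExponentialFields.macintyreWilkie_existential_of_schanuelProperty`).

Jones–Servi 2011 (transposing Macintyre–Wilkie 1996, §5), proof of Thm. 3.11: having polynomials
`p₁, …, pₙ` generating (up to the non-vanishing factor `p₀`) the ideal of the point
`(ā, ā^α)` and the identity `p₀ · g̃ = Σ bⱼ pⱼ`, "Using the fact that `ā ∈ V^{reg}(F)`, we easily
see that `(ā, h₀(ā)⁻¹) ∈ ℝⁿ⁺¹` is a regular solution of the system `H = 0`", where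
`H = (h₁, …, hₙ, x_{n+1} h₀(x̄) − 1)`, `hᵢ(x̄) = pᵢ(x̄, x̄^α)`.  This file proves, for `exp` in place
of `x^α`, the calculus and linear algebra behind "we easily see":

* `expEval P x = P(x̄, e^{x̄})` for `P ∈ ℤ[x₁…x_N, y₁…y_N]` (`MvPolynomial (Fin N ⊕ Fin N) ℤ`), its
  smoothness, and **its partial derivatives in terms of `MvPolynomial.pderiv`**
  (`hasDerivAt_expEval_update`, `fderiv_expEval_single`):
  `∂ₖ [P(x̄, e^{x̄})] = (∂_{xₖ}P)(x̄, e^{x̄}) + e^{xₖ} (∂_{yₖ}P)(x̄, e^{x̄})`;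
* the Jacobian matrix `expJac M x` of a family `M : Fin N → ℤ[x̄, ȳ]` and
  `toMatrix'_fderiv_expEval_pi`;
* **`det_expJac_ne_zero_of_identities`**: if `p₀ · fᵢ = Σₗ bᵢₗ Mₗ` for all `i`, the `Mₗ` and `fᵢ`
  vanish at `x̄` (i.e. at `(x̄, e^{x̄})`), `p₀(x̄, e^{x̄}) ≠ 0` and the Jacobian of `(fᵢ)` at `x̄` is
  invertible, then so is the Jacobian of `(Mₗ)` — by differentiating the identities:
  `p₀ · Jf = B · JM` at the point.

Everything here is proved; the construction of `H` (one more variable) and its non-singular zero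
are left to the assembly file.

## References

* G. O. Jones, T. Servi, *On the decidability of the real field with a generic power function*,
  J. Symb. Log. 76 (2011), Thm. 3.11 (proof).
* A. Macintyre, A. J. Wilkie, *On the decidability of the real exponential field* (1996), §5.
-/

noncomputable section

open scoped BigOperators Matrix
open MvPolynomial

namespace Literature.ModelTheory.ExponentialFields

namespace ExpPoly

variable {N : ℕ}

/-- The valuation `(x̄, e^{x̄})` of the variables `Fin N ⊕ Fin N`. [folklore] -/
def expPt (x : Fin N → ℝ) : Fin N ⊕ Fin N → ℝ := Sum.elim x (Real.exp ∘ x)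

/-- `expPt` on an `x`-variable. [folklore] -/
@[simp] theorem expPt_inl (x : Fin N → ℝ) (i : Fin N) : expPt x (Sum.inl i) = x i := rfl
/-- `expPt` on a `y`-variable. [folklore] -/
@[simp] theorem expPt_inr (x : Fin N → ℝ) (i : Fin N) : expPt x (Sum.inr i) = Real.exp (x i) := rfl

/-- **The flat exponential polynomial map** `x̄ ↦ P(x̄, e^{x̄})` of `P ∈ ℤ[x̄, ȳ]`. [folklore] -/
def expEval (P : MvPolynomial (Fin N ⊕ Fin N) ℤ) (x : Fin N → ℝ) : ℝ :=
  MvPolynomial.aeval (expPt x) P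

/-- `expEval` is a ring homomorphism in `P` (it is `aeval`): constants. [folklore] -/
@[simp] theorem expEval_C (a : ℤ) (x : Fin N → ℝ) : expEval (C a : MvPolynomial (Fin N ⊕ Fin N) ℤ) x = a := by
  simp [expEval]
/-- `expEval` of a variable. [folklore] -/
@[simp] theorem expEval_X (v : Fin N ⊕ Fin N) (x : Fin N → ℝ) : expEval (X v) x = expPt x v := by
  simp [expEval]
/-- `expEval 0 = 0`. [folklore] -/
@[simp] theorem expEval_zero (x : Fin N → ℝ) : expEval (0 : MvPolynomial (Fin N ⊕ Fin N) ℤ) x = 0 := by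
  simp [expEval]
/-- `expEval 1 = 1`. [folklore] -/
@[simp] theorem expEval_one (x : Fin N → ℝ) : expEval (1 : MvPolynomial (Fin N ⊕ Fin N) ℤ) x = 1 := by
  simp [expEval]
/-- `expEval` is additive. [folklore] -/
@[simp] theorem expEval_add (P Q : MvPolynomial (Fin N ⊕ Fin N) ℤ) (x : Fin N → ℝ) :
    expEval (P + Q) x = expEval P x + expEval Q x := by simp [expEval]
/-- `expEval` is multiplicative. [folklore] -/
@[simp] theorem expEval_mul (P Q : MvPolynomial (Fin N ⊕ Fin N) ℤ) (x : Fin N → ℝ) :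
    expEval (P * Q) x = expEval P x * expEval Q x := by simp [expEval]
/-- `expEval` of a finite sum. [folklore] -/
theorem expEval_sum {ι : Type*} (s : Finset ι) (P : ι → MvPolynomial (Fin N ⊕ Fin N) ℤ) (x : Fin N → ℝ) :
    expEval (∑ i ∈ s, P i) x = ∑ i ∈ s, expEval (P i) x := by simp [expEval, map_sum]

/-- The coordinate and exponential-of-coordinate functions are smooth. [folklore] -/
theorem contDiff_expPt (v : Fin N ⊕ Fin N) {m : WithTop ℕ∞} : ContDiff ℝ m fun x : Fin N → ℝ => expPt x v := by
  rcases v with i | i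
  · exact contDiff_apply ℝ ℝ i
  · exact Real.contDiff_exp.comp (contDiff_apply ℝ ℝ i)

/-- **Flat exponential polynomial maps are smooth.** [folklore] -/
theorem contDiff_expEval {m : WithTop ℕ∞} : ∀ P : MvPolynomial (Fin N ⊕ Fin N) ℤ, ContDiff ℝ m (expEval P) := by
  intro P
  induction P using MvPolynomial.induction_on with
  | C a =>
    have e : expEval (C a : MvPolynomial (Fin N ⊕ Fin N) ℤ) = fun _ => (a : ℝ) := funext fun x => expEval_C a x
    rw [e]
    exact contDiff_const
  | add p q hp hq =>
    have e : expEval (p + q) = fun x => expEval p x + expEval q x := funext fun x => expEval_add p q x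
    rw [e]
    exact hp.add hq
  | mul_X p v hp =>
    have e : expEval (p * X v) = fun x => expEval p x * expPt x v := funext fun x => by
      rw [expEval_mul, expEval_X]
    rw [e]
    exact hp.mul (contDiff_expPt v (m := m))

/-- The formula for the partial derivative `∂ₖ [P(x̄, e^{x̄})]`:
`(∂_{xₖ}P)(x̄, e^{x̄}) + e^{xₖ} · (∂_{yₖ}P)(x̄, e^{x̄})`. [folklore] -/
def expPD (k : Fin N) (P : MvPolynomial (Fin N ⊕ Fin N) ℤ) (x : Fin N → ℝ) : ℝ :=
  expEval (pderiv (Sum.inl k) P) x + Real.exp (x k) * expEval (pderiv (Sum.inr k) P) x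

/-- **Partial derivatives of flat exponential polynomial maps** along the `k`-th coordinate line,
in terms of `MvPolynomial.pderiv`. [folklore] -/
theorem hasDerivAt_expEval_update (k : Fin N) (x : Fin N → ℝ) :
    ∀ P : MvPolynomial (Fin N ⊕ Fin N) ℤ,
      HasDerivAt (fun s : ℝ => expEval P (Function.update x k s)) (expPD k P x) (x k) := by
  classical
  intro P
  induction P using MvPolynomial.induction_on with
  | C a =>
    have e : (fun s : ℝ => expEval (C a : MvPolynomial (Fin N ⊕ Fin N) ℤ) (Function.update x k s)) =
        fun _ => (a : ℝ) := funext fun s => expEval_C a _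
    rw [e]
    simpa [expPD, pderiv_C] using hasDerivAt_const (x k) (a : ℝ)
  | add p q hp hq =>
    have e : (fun s : ℝ => expEval (p + q) (Function.update x k s)) =
        fun s => expEval p (Function.update x k s) + expEval q (Function.update x k s) :=
      funext fun s => expEval_add p q _
    rw [e]
    refine (hp.add hq).congr_deriv ?_
    simp only [expPD, map_add, expEval_add]
    ring
  | mul_X p v hp =>
    -- the factor `X v` along the line
    have hv : HasDerivAt (fun s : ℝ => expPt (Function.update x k s) v)
        (expPD k (X v) x) (x k) := by
      rcases v with j | j
      · by_cases hjk : j = k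
        · subst hjk
          have : (fun s : ℝ => expPt (Function.update x j s) (Sum.inl j)) = fun s => s := by
            funext s; simp [expPt]
          rw [this]
          refine (hasDerivAt_id' (x j)).congr_deriv ?_
          simp [expPD, pderiv_X]
        · have : (fun s : ℝ => expPt (Function.update x k s) (Sum.inl j)) = fun _ => x j := by
            funext s; simp [expPt, Function.update_of_ne hjk]
          rw [this]
          refine (hasDerivAt_const (x k) (x j)).congr_deriv ?_
          simp [expPD, pderiv_X, hjk]
      · by_cases hjk : j = k
        · subst hjk
          have : (fun s : ℝ => expPt (Function.update x j s) (Sum.inr j)) = fun s => Real.exp s := by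
            funext s; simp [expPt]
          rw [this]
          refine (Real.hasDerivAt_exp (x j)).congr_deriv ?_
          simp [expPD, pderiv_X]
        · have : (fun s : ℝ => expPt (Function.update x k s) (Sum.inr j)) = fun _ => Real.exp (x j) := by
            funext s; simp [expPt, Function.update_of_ne hjk]
          rw [this]
          refine (hasDerivAt_const (x k) (Real.exp (x j))).congr_deriv ?_
          simp [expPD, pderiv_X, hjk]
    have e : (fun s : ℝ => expEval (p * X v) (Function.update x k s)) =
        fun s => expEval p (Function.update x k s) * expPt (Function.update x k s) v :=
      funext fun s => by rw [expEval_mul, expEval_X]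
    rw [e]
    refine (hp.mul hv).congr_deriv ?_
    rw [Function.update_eq_self]
    simp only [expPD, Derivation.leibniz, smul_eq_mul, expEval_add, expEval_mul, expEval_X]
    ring

/-- **The Fréchet derivative of a flat exponential polynomial map on a coordinate vector** is
`expPD`. [folklore] -/
theorem fderiv_expEval_single (P : MvPolynomial (Fin N ⊕ Fin N) ℤ) (x : Fin N → ℝ) (k : Fin N) :
    fderiv ℝ (expEval P) x (Pi.single k 1) = expPD k P x := by
  have hd : DifferentiableAt ℝ (expEval P) x :=
    ((contDiff_expEval (m := 1) P).differentiable (by simp)) x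
  have h1 : HasDerivAt (fun s : ℝ => expEval P (Function.update x k s))
      (fderiv ℝ (expEval P) x (Pi.single k 1)) (x k) := by
    have hf : HasFDerivAt (expEval P) (fderiv ℝ (expEval P) x) (Function.update x k (x k)) := by
      rw [Function.update_eq_self]; exact hd.hasFDerivAt
    exact hf.comp_hasDerivAt (x k) (hasDerivAt_update x k (x k))
  exact h1.unique (hasDerivAt_expEval_update k x P)

/-! ### Jacobians of square families -/

/-- The Jacobian matrix of the map `x̄ ↦ (Mₗ(x̄, e^{x̄}))ₗ` at `x̄`. [folklore] -/
def expJac (M : Fin N → MvPolynomial (Fin N ⊕ Fin N) ℤ) (x : Fin N → ℝ) : Matrix (Fin N) (Fin N) ℝ :=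
  Matrix.of fun l k => expPD k (M l) x

/-- The matrix of the Fréchet derivative of the map of a family is its Jacobian matrix. [folklore] -/
theorem toMatrix'_fderiv_expEval_pi (M : Fin N → MvPolynomial (Fin N ⊕ Fin N) ℤ) (x : Fin N → ℝ) :
    LinearMap.toMatrix' (fderiv ℝ (fun x l => expEval (M l) x) x : (Fin N → ℝ) →ₗ[ℝ] (Fin N → ℝ)) =
      expJac M x := by
  ext l k
  rw [LinearMap.toMatrix'_apply, ContinuousLinearMap.coe_coe,
    fderiv_pi fun l => ((contDiff_expEval (m := 1) (M l)).differentiable (by simp)).differentiableAt]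
  rw [ContinuousLinearMap.pi_apply, fderiv_expEval_single]
  rfl

/-- The determinant of the Fréchet derivative of the map of a family is the Jacobian determinant. [folklore] -/
theorem det_fderiv_expEval_pi (M : Fin N → MvPolynomial (Fin N ⊕ Fin N) ℤ) (x : Fin N → ℝ) :
    LinearMap.det (fderiv ℝ (fun x l => expEval (M l) x) x : (Fin N → ℝ) →ₗ[ℝ] (Fin N → ℝ)) =
      (expJac M x).det := by
  rw [← LinearMap.det_toMatrix', toMatrix'_fderiv_expEval_pi]

/-! ### Transfer of non-singularity along polynomial identities -/

/-- **Differentiating the identities `p₀ fᵢ = Σₗ bᵢₗ Mₗ` at a common zero.**  If all `fᵢ` and `Mₗ`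
vanish at `x̄` (i.e. at `(x̄, e^{x̄})`), then `p₀(x̄) · ∂ₖfᵢ(x̄) = Σₗ bᵢₗ(x̄) · ∂ₖMₗ(x̄)`. [folklore] -/
theorem expPD_identity {f M : Fin N → MvPolynomial (Fin N ⊕ Fin N) ℤ}
    {p₀ : MvPolynomial (Fin N ⊕ Fin N) ℤ} {b : Fin N → Fin N → MvPolynomial (Fin N ⊕ Fin N) ℤ}
    (hid : ∀ i, p₀ * f i = ∑ l, b i l * M l) {x : Fin N → ℝ}
    (hf : ∀ i, expEval (f i) x = 0) (hM : ∀ l, expEval (M l) x = 0) (i k : Fin N) :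
    expEval p₀ x * expPD k (f i) x = ∑ l, expEval (b i l) x * expPD k (M l) x := by
  -- apply the derivation `pderiv w`, evaluate, for `w = inl k` and `w = inr k`
  have key : ∀ w : Fin N ⊕ Fin N,
      expEval p₀ x * expEval (pderiv w (f i)) x = ∑ l, expEval (b i l) x * expEval (pderiv w (M l)) x := by
    intro w
    have h := congrArg (fun Q => expEval (pderiv w Q) x) (hid i)
    simp only [map_sum, Derivation.leibniz, smul_eq_mul, expEval_add, expEval_mul, expEval_sum,
      hf, hM] at h
    simpa [mul_comm] using h
  simp only [expPD, mul_add, Finset.sum_add_distrib]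
  rw [key (Sum.inl k)]
  congr 1
  have := key (Sum.inr k)
  calc expEval p₀ x * (Real.exp (x k) * expEval (pderiv (Sum.inr k) (f i)) x)
      = Real.exp (x k) * (expEval p₀ x * expEval (pderiv (Sum.inr k) (f i)) x) := by ring
    _ = Real.exp (x k) * ∑ l, expEval (b i l) x * expEval (pderiv (Sum.inr k) (M l)) x := by rw [this]
    _ = ∑ l, expEval (b i l) x * (Real.exp (x k) * expEval (pderiv (Sum.inr k) (M l)) x) := by
        rw [Finset.mul_sum]; exact Finset.sum_congr rfl fun l _ => by ring

/-- **Non-singularity transfers along the identities** (the "easy" regularity of `H` in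
Jones–Servi 2011, proof of Thm. 3.11): under the hypotheses of `expPD_identity`, if moreover
`p₀(x̄) ≠ 0` and the Jacobian of `(fᵢ)` at `x̄` is invertible, then the Jacobian of `(Mₗ)` at `x̄`
is invertible: `p₀ · Jf = B · JM`, so `p₀ᴺ det Jf = det B · det JM`. [cite: JonesServi2011, Thm. 3.11 (proof)] -/
theorem det_expJac_ne_zero_of_identities {f M : Fin N → MvPolynomial (Fin N ⊕ Fin N) ℤ}
    {p₀ : MvPolynomial (Fin N ⊕ Fin N) ℤ} {b : Fin N → Fin N → MvPolynomial (Fin N ⊕ Fin N) ℤ}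
    (hid : ∀ i, p₀ * f i = ∑ l, b i l * M l) {x : Fin N → ℝ}
    (hf : ∀ i, expEval (f i) x = 0) (hM : ∀ l, expEval (M l) x = 0) (hp₀ : expEval p₀ x ≠ 0)
    (hJf : (expJac f x).det ≠ 0) : (expJac M x).det ≠ 0 := by
  set B : Matrix (Fin N) (Fin N) ℝ := Matrix.of fun i l => expEval (b i l) x with hB
  have hmat : expEval p₀ x • expJac f x = B * expJac M x := by
    ext i k
    rw [Matrix.smul_apply, smul_eq_mul, Matrix.mul_apply]
    simp only [expJac, Matrix.of_apply, hB]
    exact expPD_identity hid hf hM i k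
  have hdet := congrArg Matrix.det hmat
  rw [Matrix.det_smul, Matrix.det_mul, Fintype.card_fin] at hdet
  intro h0
  rw [h0, mul_zero] at hdet
  exact (mul_ne_zero (pow_ne_zero _ hp₀) hJf) hdet

end ExpPoly

end Literature.ModelTheory.ExponentialFields

end
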